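import Summits.AtomisticToContinuum.HydrodynamicLimit.Theorems.InformationPercolationEnginePercolationClosesChaosForecastReveal
import Summits.AtomisticToContinuum.HydrodynamicLimit.Theorems.InformationPercolationEnginePercolationClosesChaosForecastObsMeasurable
import HarnessLib

/-!
# Forecast transfer S6 of the line `equilibrium-forecast-chain-rule` (crux `InformationPercolationEngine.PercolationClosesChaos`,
stmt-AtomisticToContinuum-15178) — piece F′: the line's two filtrations — identities and Borel measurability

Support file (`--supports stmt-AtomisticToContinuum-15178`) of the registered stub `stub_forecastTransfer` (worker S6 of lead
c3); companion of piece F (`…ForecastReveal`: the observation sequence `revealSeq L` of a label rule, `Yseq` / `YseqEnd`, and the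
σ-algebra identities `pastSigma (revealSeq L) (kM + cellRank h q) = comap (revealHist L k q) ⊤`, `… + 1 ↦ revealHistLE`) and of
piece O (`…ForecastObsMeasurable`: the atoms of one observation `obs … k · i` are Borel). Here, in the line's own vocabulary:

* the IDENTITIES: `pastSigma_Yseq_eq_seqHist` (registered headline) — `pastSigma (Yseq b c σ N Φ) (kM + cellRank h q) =
  MeasurableSpace.comap (seqHist b c σ N Φ k q) ⊤`; `pastSigma_Yseq_succ_eq_seqHistLE` (`… + 1 = comap (seqHistLE …) ⊤`);
  `pastSigma_YseqEnd_eq_seqHistEnd` (`pastSigma (YseqEnd …) (kM + cellRank h q) = comap (seqHistEnd …) ⊤`, S5's conditioning);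
  `pastSigma_YseqEnd_succ_eq`; `measurable_pastSigma_Yseq_succ_of_imp` (a function constant on the atoms of `seqHistLE k q` is
  adapted at stage `kM + cellRank h q + 1` — the second hypothesis of `PredictableProjection` for revealed increments);
* MEASURABILITY (every flow, label rule, `k`, `q`; no positivity needed): `measurableSet_obsVec_eq`, `measurableSet_fiber_of_obs`,
  `comap_top_le_of_obs` (a countably-valued function of finitely many observation snapshots generates a sub-σ-algebra of the
  Borel one); `pastSigma_revealSeq_le`, `comap_revealHist_le`, `comap_revealHistLE_le`, `measurableSet_revealHist_eq`,
  `measurableSet_revealHistLE_eq`; and the specialisations `pastSigma_Yseq_le` (registered: the first hypothesis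
  `∀ n, pastSigma Y n ≤ ‹MeasurableSpace Ω›` of `PredictableProjection`), `pastSigma_YseqEnd_le`, `comap_seqHist_le`,
  `comap_seqHistEnd_le`, `comap_seqHistLE_le` (the `condExp`s of `MesoConditionalEquidistribution` (a)/(b) are genuine),
  `measurableSet_seqHist_eq`, `measurableSet_seqHistEnd_eq`, `measurableSet_seqHistLE_eq` (atoms Borel).
-/

noncomputable section

open MeasureTheory Set Filter Topology
open scoped ENNReal BigOperators Classical
open Literature.Analysis.FluidPDE Literature.MathematicalPhysics.KineticTheory
open Literature.MathematicalPhysics.KineticTheory.VelocityBlindPlacement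

namespace Summit.AtomisticToContinuum.HydrodynamicLimit.Theorems.EquilibriumForecastLine

/-! ## The identities for `Yseq` and `YseqEnd` -/

section LineIds

variable {σ : ℝ} {N : ℕ} (Φ : Flow σ N) (b c : ℝ)

/-- **Registered helper `pastSigma_Yseq_eq_seqHist` (pieces F/F′ of S5/S6, the filtration backbone): the past of the START-CELL
observation sequence `Yseq` before unit `(k, q)` — stage `k · #cellBox (cℓ_N) + cellRank (cℓ_N) q` — IS the σ-algebra of the
start-cell sequential history, `MeasurableSpace.comap (seqHist b c σ N Φ k q) ⊤`** (`0 < σ`, `0 < c`, `q` in the box). Hence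
`MesoConditionalEquidistribution` (a)'s conditional expectations are the engine's forecasts verbatim. [folklore] -/
theorem pastSigma_Yseq_eq_seqHist : ∀ {σ : ℝ} {N : ℕ} (Φ : Flow σ N) (b c : ℝ), 0 < σ → 0 < c → ∀ (k : ℕ) (q : Cell), q ∈ cellBox (c * meanFreePath σ N) → pastSigma (Yseq b c σ N Φ) (k * (cellBox (c * meanFreePath σ N)).card + cellRank (c * meanFreePath σ N) q) = MeasurableSpace.comap (seqHist b c σ N Φ k q) ⊤ := by
  intro σ N Φ b c hσ hc k q hq
  rw [seqHist_eq_revealHist]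
  exact pastSigma_revealSeq_eq Φ b c (fun o _ => o.1.1)
    (fun k z i => obs_cell_mem_cellBox Φ b c (mul_pos hc (meanFreePath_pos hσ N)) k z i) hq k

/-- **The past of `Yseq` right after unit `(k, q)` — stage `kM + cellRank h q + 1` — IS `σ(seqHistLE k q)`**: the σ-algebra
to which the increment of unit `(k, q)` must be adapted. [folklore] -/
theorem pastSigma_Yseq_succ_eq_seqHistLE (hσ : 0 < σ) (hc : 0 < c) (k : ℕ) {q : Cell}
    (hq : q ∈ cellBox (c * meanFreePath σ N)) :
    pastSigma (Yseq b c σ N Φ)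
        (k * (cellBox (c * meanFreePath σ N)).card + cellRank (c * meanFreePath σ N) q + 1) =
      MeasurableSpace.comap (seqHistLE b c σ N Φ k q) ⊤ := by
  rw [seqHistLE_eq_revealHistLE]
  exact pastSigma_revealSeq_succ_eq Φ b c (fun o _ => o.1.1)
    (fun k z i => obs_cell_mem_cellBox Φ b c (mul_pos hc (meanFreePath_pos hσ N)) k z i) hq k

/-- **The past of the END-CELL observation sequence `YseqEnd` before unit `(k, q)` IS `σ(seqHistEnd k q)`** — the conditioning
of `MesoConditionalEquidistribution` (b), consumed by S5. [folklore] -/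
theorem pastSigma_YseqEnd_eq_seqHistEnd (hσ : 0 < σ) (hc : 0 < c) (k : ℕ) {q : Cell}
    (hq : q ∈ cellBox (c * meanFreePath σ N)) :
    pastSigma (YseqEnd b c σ N Φ)
        (k * (cellBox (c * meanFreePath σ N)).card + cellRank (c * meanFreePath σ N) q) =
      MeasurableSpace.comap (seqHistEnd b c σ N Φ k q) ⊤ := by
  rw [seqHistEnd_eq_revealHist]
  exact pastSigma_revealSeq_eq Φ b c (fun _ o' => o'.1.1)
    (fun k z i => obs_cell_mem_cellBox Φ b c (mul_pos hc (meanFreePath_pos hσ N)) (k + 1) z i) hq k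

/-- The past of `YseqEnd` right after unit `(k, q)` is `σ(revealHistLE (end labels) k q)` (the past plus the step-`k`
observations of the spheres whose END cell is `≤ₗₑₓ q`). [folklore] -/
theorem pastSigma_YseqEnd_succ_eq (hσ : 0 < σ) (hc : 0 < c) (k : ℕ) {q : Cell}
    (hq : q ∈ cellBox (c * meanFreePath σ N)) :
    pastSigma (YseqEnd b c σ N Φ)
        (k * (cellBox (c * meanFreePath σ N)).card + cellRank (c * meanFreePath σ N) q + 1) =
      MeasurableSpace.comap (revealHistLE b c σ N Φ (fun _ o' => o'.1.1) k q) ⊤ :=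
  pastSigma_revealSeq_succ_eq Φ b c (fun _ o' => o'.1.1)
    (fun k z i => obs_cell_mem_cellBox Φ b c (mul_pos hc (meanFreePath_pos hσ N)) (k + 1) z i) hq k

/-- **Adaptedness of revealed increments**: a function of the initial datum that is constant on the atoms of `seqHistLE k q`
is measurable for the past of `Yseq` right after unit `(k, q)` (the second hypothesis of `PredictableProjection` for the
increment placed at stage `kM + cellRank h q`). [folklore] -/
theorem measurable_pastSigma_Yseq_succ_of_imp {β : Type*} [MeasurableSpace β] (hσ : 0 < σ) (hc : 0 < c) (k : ℕ) {q : Cell}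
    (hq : q ∈ cellBox (c * meanFreePath σ N)) {X : Phase N → β}
    (hX : ∀ z z', seqHistLE b c σ N Φ k q z = seqHistLE b c σ N Φ k q z' → X z = X z') :
    Measurable[pastSigma (Yseq b c σ N Φ)
      (k * (cellBox (c * meanFreePath σ N)).card + cellRank (c * meanFreePath σ N) q + 1)] X := by
  rw [pastSigma_Yseq_succ_eq_seqHistLE Φ b c hσ hc k hq]
  exact measurable_comap_top_of_imp hX

end LineIds

/-! ## Functions of finitely many observation snapshots are Borel -/

section Obs

variable {σ : ℝ} {N : ℕ} (Φ : Flow σ N) (b c : ℝ)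

/-- The atoms of the vector of the first `n` observation snapshots are Borel (piece O). [folklore] -/
theorem measurableSet_obsVec_eq (n : ℕ) (v : Fin n → Fin (N + 1) → Obs N) :
    MeasurableSet {z : Phase N | (fun (j : Fin n) (i : Fin (N + 1)) => obs b c σ N Φ j z i) = v} := by
  have hset : {z : Phase N | (fun (j : Fin n) (i : Fin (N + 1)) => obs b c σ N Φ j z i) = v} =
      ⋂ j : Fin n, ⋂ i : Fin (N + 1), {z | obs b c σ N Φ j z i = v j i} := by
    ext z
    simp only [mem_setOf_eq, mem_iInter, funext_iff]
  rw [hset]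
  exact MeasurableSet.iInter fun j => MeasurableSet.iInter fun i => measurableSet_obs_eq Φ b c j i (v j i)

/-- **A function of the first `n` observation snapshots has Borel fibres.** [folklore] -/
theorem measurableSet_fiber_of_obs {A : Type*} {f : Phase N → A} (n : ℕ)
    (hf : ∀ z z', (∀ j < n, obs b c σ N Φ j z = obs b c σ N Φ j z') → f z = f z') (a : A) :
    MeasurableSet {z | f z = a} :=
  measurableSet_fiber_of_factors (g := fun z (j : Fin n) (i : Fin (N + 1)) => obs b c σ N Φ j z i)
    (fun v => measurableSet_obsVec_eq Φ b c n v)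
    (fun z z' h => hf z z' fun j hj => funext fun i => congrFun (congrFun h ⟨j, hj⟩) i) a

/-- A countably-valued function of the first `n` observation snapshots generates a sub-σ-algebra of the Borel one. [folklore] -/
theorem comap_top_le_of_obs {A : Type*} [Countable A] {f : Phase N → A} (n : ℕ)
    (hf : ∀ z z', (∀ j < n, obs b c σ N Φ j z = obs b c σ N Φ j z') → f z = f z') :
    MeasurableSpace.comap f ⊤ ≤ (inferInstance : MeasurableSpace (Phase N)) :=
  comap_top_le_of_fibers (measurableSet_fiber_of_obs Φ b c n hf)

end Obs

/-! ## Every label rule: the past and the atoms are Borel -/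

section Fibres

variable {σ : ℝ} {N : ℕ} (Φ : Flow σ N) (b c : ℝ) (L : Obs N → Obs N → Cell)

/-- Each revelation is a function of the first `n + 2` observation snapshots. [folklore] -/
theorem revealSeq_eq_of_obs_eq (n : ℕ) (z z' : Phase N) (h : ∀ j < n + 2, obs b c σ N Φ j z = obs b c σ N Φ j z') :
    revealSeq b c σ N Φ L n z = revealSeq b c σ N Φ L n z' := by
  cases n with
  | zero =>
    show (fun i => some (obs b c σ N Φ 0 z i)) = fun i => some (obs b c σ N Φ 0 z' i)
    rw [h 0 (by omega)]
  | succ n =>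
    have h1 : n / (cellBox (c * meanFreePath σ N)).card < n + 1 + 2 :=
      lt_of_le_of_lt (Nat.div_le_self _ _) (by omega)
    have h2 : n / (cellBox (c * meanFreePath σ N)).card + 1 < n + 1 + 2 :=
      lt_of_le_of_lt (Nat.succ_le_succ (Nat.div_le_self _ _)) (by omega)
    funext i
    show (if cellRank (c * meanFreePath σ N) (L (obs b c σ N Φ (n / (cellBox (c * meanFreePath σ N)).card) z i)
      (obs b c σ N Φ (n / (cellBox (c * meanFreePath σ N)).card + 1) z i)) = n % (cellBox (c * meanFreePath σ N)).card
      then some (obs b c σ N Φ (n / (cellBox (c * meanFreePath σ N)).card + 1) z i) else none) =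
      if cellRank (c * meanFreePath σ N) (L (obs b c σ N Φ (n / (cellBox (c * meanFreePath σ N)).card) z' i)
      (obs b c σ N Φ (n / (cellBox (c * meanFreePath σ N)).card + 1) z' i)) = n % (cellBox (c * meanFreePath σ N)).card
      then some (obs b c σ N Φ (n / (cellBox (c * meanFreePath σ N)).card + 1) z' i) else none
    rw [h _ h1, h _ h2]

/-- **The past of the observation sequence is below the Borel σ-algebra at every stage** (every label rule, every flow;
no positivity needed). [folklore] -/
theorem pastSigma_revealSeq_le (n : ℕ) :
    pastSigma (revealSeq b c σ N Φ L) n ≤ (inferInstance : MeasurableSpace (Phase N)) := by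
  refine comap_top_le_of_obs Φ b c (n + 2) fun z z' h => funext fun m => ?_
  exact revealSeq_eq_of_obs_eq Φ b c L m z z' fun j hj => h j (by omega)

/-- `σ(revealHist L k q)` is below the Borel σ-algebra (every `k`, `q`). [folklore] -/
theorem comap_revealHist_le (k : ℕ) (q : Cell) :
    MeasurableSpace.comap (revealHist b c σ N Φ L k q) ⊤ ≤ (inferInstance : MeasurableSpace (Phase N)) := by
  refine comap_top_le_of_obs Φ b c (k + 2) fun z z' h => ?_
  unfold revealHist hist
  rw [h k (by omega), h (k + 1) (by omega)]
  congr 1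
  exact funext fun j => h j (by omega)

/-- `σ(revealHistLE L k q)` is below the Borel σ-algebra (every `k`, `q`). [folklore] -/
theorem comap_revealHistLE_le (k : ℕ) (q : Cell) :
    MeasurableSpace.comap (revealHistLE b c σ N Φ L k q) ⊤ ≤ (inferInstance : MeasurableSpace (Phase N)) := by
  refine comap_top_le_of_obs Φ b c (k + 2) fun z z' h => ?_
  unfold revealHistLE hist
  rw [h k (by omega), h (k + 1) (by omega)]
  congr 1
  exact funext fun j => h j (by omega)

/-- The atoms of `revealHist L k q` are Borel. [folklore] -/
theorem measurableSet_revealHist_eq (k : ℕ) (q : Cell)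
    (y : (Fin (k + 1) → Fin (N + 1) → Obs N) × (Fin (N + 1) → Option (Obs N))) :
    MeasurableSet {z : Phase N | revealHist b c σ N Φ L k q z = y} :=
  measurableSet_preimage_of_comap_top_le (comap_revealHist_le Φ b c L k q) {y}

/-- The atoms of `revealHistLE L k q` are Borel. [folklore] -/
theorem measurableSet_revealHistLE_eq (k : ℕ) (q : Cell)
    (y : (Fin (k + 1) → Fin (N + 1) → Obs N) × (Fin (N + 1) → Option (Obs N))) :
    MeasurableSet {z : Phase N | revealHistLE b c σ N Φ L k q z = y} :=
  measurableSet_preimage_of_comap_top_le (comap_revealHistLE_le Φ b c L k q) {y}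

end Fibres

/-! ## The line's two filtrations: measurability -/

section Line

variable {σ : ℝ} {N : ℕ} (Φ : Flow σ N) (b c : ℝ)

/-- **Registered helper `pastSigma_Yseq_le` (piece F′ of S5/S6): the past of the start-cell observation sequence is below the
Borel σ-algebra of the phase space at EVERY stage** — the first hypothesis of `PredictableProjection` for `Ω = Phase N`,
`Y = Yseq b c σ N Φ` (every flow of the crux, bin width, scale; no positivity needed). [folklore] -/
theorem pastSigma_Yseq_le : ∀ {σ : ℝ} {N : ℕ} (Φ : Flow σ N) (b c : ℝ) (n : ℕ), pastSigma (Yseq b c σ N Φ) n ≤ (inferInstance : MeasurableSpace (Phase N)) := by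
  intro σ N Φ b c n
  exact pastSigma_revealSeq_le Φ b c (fun o _ => o.1.1) n

/-- `pastSigma (YseqEnd …) n ≤` Borel for every stage. [folklore] -/
theorem pastSigma_YseqEnd_le (n : ℕ) : pastSigma (YseqEnd b c σ N Φ) n ≤ (inferInstance : MeasurableSpace (Phase N)) :=
  pastSigma_revealSeq_le Φ b c (fun _ o' => o'.1.1) n

/-- `σ(seqHist k q) ≤` Borel (every `k`, `q`): MCE (a)'s `condExp` is a genuine conditional expectation. [folklore] -/
theorem comap_seqHist_le (k : ℕ) (q : Cell) :
    MeasurableSpace.comap (seqHist b c σ N Φ k q) ⊤ ≤ (inferInstance : MeasurableSpace (Phase N)) :=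
  comap_revealHist_le Φ b c (fun o _ => o.1.1) k q

/-- `σ(seqHistEnd k q) ≤` Borel (every `k`, `q`): MCE (b)'s `condExp` is a genuine conditional expectation. [folklore] -/
theorem comap_seqHistEnd_le (k : ℕ) (q : Cell) :
    MeasurableSpace.comap (seqHistEnd b c σ N Φ k q) ⊤ ≤ (inferInstance : MeasurableSpace (Phase N)) :=
  comap_revealHist_le Φ b c (fun _ o' => o'.1.1) k q

/-- `σ(seqHistLE k q) ≤` Borel (every `k`, `q`). [folklore] -/
theorem comap_seqHistLE_le (k : ℕ) (q : Cell) :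
    MeasurableSpace.comap (seqHistLE b c σ N Φ k q) ⊤ ≤ (inferInstance : MeasurableSpace (Phase N)) :=
  comap_revealHistLE_le Φ b c (fun o _ => o.1.1) k q

/-- The atoms of the start-cell sequential history are Borel. [folklore] -/
theorem measurableSet_seqHist_eq (k : ℕ) (q : Cell)
    (y : (Fin (k + 1) → Fin (N + 1) → Obs N) × (Fin (N + 1) → Option (Obs N))) :
    MeasurableSet {z : Phase N | seqHist b c σ N Φ k q z = y} :=
  measurableSet_revealHist_eq Φ b c (fun o _ => o.1.1) k q y

/-- The atoms of the end-cell sequential history are Borel. [folklore] -/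
theorem measurableSet_seqHistEnd_eq (k : ℕ) (q : Cell)
    (y : (Fin (k + 1) → Fin (N + 1) → Obs N) × (Fin (N + 1) → Option (Obs N))) :
    MeasurableSet {z : Phase N | seqHistEnd b c σ N Φ k q z = y} :=
  measurableSet_revealHist_eq Φ b c (fun _ o' => o'.1.1) k q y

/-- The atoms of the post-revelation history are Borel. [folklore] -/
theorem measurableSet_seqHistLE_eq (k : ℕ) (q : Cell)
    (y : (Fin (k + 1) → Fin (N + 1) → Obs N) × (Fin (N + 1) → Option (Obs N))) :
    MeasurableSet {z : Phase N | seqHistLE b c σ N Φ k q z = y} :=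
  measurableSet_revealHistLE_eq Φ b c (fun o _ => o.1.1) k q y

end Line

end Summit.AtomisticToContinuum.HydrodynamicLimit.Theorems.EquilibriumForecastLine

end
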